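import Mathlib.LinearAlgebra.Matrix.Kronecker
import Literature.MathematicalPhysics.QuantumLattice.ProductOperators
import HarnessLib

/-!
# Product operators: relabelling sites, and peeling one site off as a Kronecker factor

Family `hubbard` / spin systems (topic `MathematicalPhysics/QuantumLattice`), companion of
`ProductOperators` (`productOp u = ⨂_x u_x`, entrywise `∏_x (u_x)_{σ_x τ_x}`, Tasaki 2020 §2.2
eq. (2.2.12)) and of `MPSBlockedTensorSweep` (sweeps of blocked MPS tensors factorise over PRODUCT
insertions `O ⊗ₖ P`). To feed a product operator on an `(n+1)`-site chain into an `n`-fold iteration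
of a two-factor Kronecker lemma one needs the elementary bookkeeping recorded here:

* `productOp_comp_equiv` — relabelling the sites along `e : Λ' ≃ Λ` is a reindexing of the tensor
  factors: `⨂_{x'} u_{e x'} = (⨂_x u_x)` read through `σ' ↦ σ' ∘ e⁻¹`;
* `productOp_submatrix_consEquiv` — **peeling the first site**: through
  `Fin.consEquiv : Fin q × (Fin n → Fin q) ≃ (Fin (n+1) → Fin q)`,
  `⨂_{i ≤ n} u_i = u_0 ⊗ₖ ⨂_{i < n} u_{i+1}`;
* `productOp_submatrix_snocEquiv` — **peeling the last site**: through `Fin.snocEquiv`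
  (which lists the LAST entry first), `⨂_{i ≤ n} u_i = u_n ⊗ₖ ⨂_{i < n} u_i`;
* `productOp_of_isEmpty` — on an empty site set the product operator is `1`.

These are the tensor-product structure maps `ℋ_Λ ≅ 𝔥_{x₀} ⊗ ℋ_{Λ ∖ x₀}` of Tasaki (2020) §2.1–§2.2
(the many-body Hilbert space as the tensor product of the single-site spaces, operators acting
sitewise), written for matrices in the computational basis. Pure finite bookkeeping; no model.

## References
* H. Tasaki, *Physics and Mathematics of Quantum Many-Body Systems*, Springer GTP (2020), §2.1
  (tensor-product structure of `ℋ_Λ`), §2.2 eq. (2.2.12) (product operators). [cite: Tasaki2020, §2.2 eq. (2.2.12)]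
-/

namespace Literature.MathematicalPhysics.QuantumLattice

open Matrix
open scoped Kronecker

section Relabel

variable {Λ Λ' : Type*} [Fintype Λ] [Fintype Λ'] {q : ℕ}

/-- **Relabelling sites.** For `e : Λ' ≃ Λ`, the product operator of the relabelled family
`u ∘ e` is the product operator of `u` with configurations read through `σ' ↦ σ' ∘ e.symm`.
Tasaki (2020) §2.2 eq. (2.2.12). [cite: Tasaki2020, §2.2 eq. (2.2.12)] -/
theorem productOp_comp_equiv (e : Λ' ≃ Λ) (u : Λ → Matrix (Fin q) (Fin q) ℂ) :
    productOp (fun x' => u (e x')) =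
      (productOp u).submatrix (fun σ' : TensorIndex Λ' q => σ' ∘ e.symm)
        (fun τ' : TensorIndex Λ' q => τ' ∘ e.symm) := by
  ext σ' τ'
  simp only [submatrix_apply, productOp_apply, Function.comp_apply]
  exact (e.prod_comp (fun x => u x (σ' (e.symm x)) (τ' (e.symm x)))).symm.trans
    (Fintype.prod_congr _ _ fun x' => by rw [e.symm_apply_apply]) |>.symm

end Relabel

section Peel

variable {q n : ℕ}

/-- **Peeling the first site.** Through `Fin.consEquiv` (a configuration of `Fin (n+1)` = its value
at `0` and its tail), `⨂_{i ≤ n} u_i = u_0 ⊗ₖ ⨂_{i < n} u_{i+1}`. Tasaki (2020) §2.1–§2.2 (tensor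
product structure), eq. (2.2.12). [cite: Tasaki2020, §2.2 eq. (2.2.12)] -/
theorem productOp_submatrix_consEquiv (u : Fin (n + 1) → Matrix (Fin q) (Fin q) ℂ) :
    (productOp u).submatrix (Fin.consEquiv fun _ => Fin q) (Fin.consEquiv fun _ => Fin q) =
      u 0 ⊗ₖ productOp (fun i : Fin n => u i.succ) := by
  ext ⟨a, σ⟩ ⟨b, τ⟩
  simp only [submatrix_apply, productOp_apply, kroneckerMap_apply, Fin.prod_univ_succ,
    Fin.consEquiv_apply, Fin.cons_zero, Fin.cons_succ]

/-- **Peeling the last site.** Through `Fin.snocEquiv` (a configuration of `Fin (n+1)` = its value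
at `last n`, listed FIRST, and its initial segment), `⨂_{i ≤ n} u_i = u_n ⊗ₖ ⨂_{i < n} u_i`.
Tasaki (2020) §2.1–§2.2, eq. (2.2.12). [cite: Tasaki2020, §2.2 eq. (2.2.12)] -/
theorem productOp_submatrix_snocEquiv (u : Fin (n + 1) → Matrix (Fin q) (Fin q) ℂ) :
    (productOp u).submatrix (Fin.snocEquiv fun _ => Fin q) (Fin.snocEquiv fun _ => Fin q) =
      u (Fin.last n) ⊗ₖ productOp (fun i : Fin n => u i.castSucc) := by
  ext ⟨a, σ⟩ ⟨b, τ⟩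
  simp only [submatrix_apply, productOp_apply, kroneckerMap_apply, Fin.prod_univ_castSucc,
    Fin.snocEquiv_apply, Fin.snoc_last, Fin.snoc_castSucc, mul_comm]

/-- On an empty set of sites the product operator is the identity (of the one-dimensional space).
Tasaki (2020) §2.2 eq. (2.2.12) (empty product). [cite: Tasaki2020, §2.2 eq. (2.2.12)] -/
theorem productOp_of_isEmpty {Λ : Type*} [Fintype Λ] [IsEmpty Λ] (u : Λ → Matrix (Fin q) (Fin q) ℂ) :
    productOp u = 1 := by
  ext σ τ
  rw [productOp_apply, Fintype.prod_empty, Subsingleton.elim σ τ, one_apply_eq]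

end Peel

end Literature.MathematicalPhysics.QuantumLattice
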